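/-
Copyright (c) 2026 the pub-hodgecm-mathlib formalisation cell (harness21).  Prover seat hodgecm-mathlib-K2E1-p13 (g4) acting for R90-TF section S8 «ContSpec-n½» (planner
R90-CS-plan (g0), DEAL 16:29:29Z «COMPLETION step»): the dictionary between the PARTIAL-`ζ_F^S` currency of the E1 scattering packages (★ `K2E1ChiScatteringEulerQuotientU2`) and the
COMPLETED-`Λ_F` currency of the centre-value file (★ `K2E1IntertwiningScalarCentreValueU2`) — the conversion factor, its holomorphy and non-vanishing on `{½ < Re}`, its VANISHING at
the centre, and the prints that carry a `ζ^S`-side tube letter to `qc(½) = −a`.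
-/
import Summits.HodgeConjecture.HodgeConjecture.Theorems.F0P2wPartialDedekindZetaPole               -- ★ `partialDedekindZeta_eq_dedekindZetaCont_mul`, thin Euler factor `E_S` (holomorphy, `≠ 0`)
import Summits.HodgeConjecture.HodgeConjecture.Theorems.K2E1IntertwiningScalarCentreValueU2        -- ★ p861943 (this seat): `γ_F`∕`Λ_F` holomorphy, `centreValue_eq_neg_of_tube_const`, `sum_centreValue_smul_eq_neg_of_const`
import HarnessLib

/-!
# K2·E1 ∕ R90·S8 — `K2E1IntertwiningScalarCompletedRatioU2`: `ζ_F^S(2z−1)∕ζ_F^S(2z) = B_S(z) · Λ_F(2z−1)∕Λ_F(2z)` ON THE TUBE, WITH `B_S` HOLOMORPHIC AND ZERO-FREE ON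
# `{½ < Re}` AND `B_S(z) → 0` AT THE CENTRE; THE `ζ^S`-CURRENCY TUBE LETTER IN CLOSED FORM GIVES `qc(½) = −a`

Cell `pub/hodgecm-mathlib`, crux h413 = `stmt-HodgeConjecture-24833`, route of record `HCCMUnconditional`; R90-TF section S8, road J2′ (R90-CS-plan 16:07:49Z (3), 16:29:29Z) for the
socket `sock_S8_ext_kysCentreU2` of `Cruxes/H413/Lines/R90_S8_ContSpecIndexA.lean` §4.  THEOREMS ONLY (no `def`, no `instance`, no notation, no named-fact hypothesis, no `sorry`;
default heartbeats); lane `--supports stmt-HodgeConjecture-24833 --as helper` (count-neutral).  Closes no socket.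

THE MATHEMATICS.  `F` a number field, `S` a FINITE set of finite places, `q_v = N(v)`; the thin Euler factor `E_S(s) = ∏_{v ∈ S} (1 − q_v^{−s})` and the gamma factor
`γ_F(s) = |d_F|^{s∕2} Γ_ℝ(s)^{r₁} Γ_ℂ(s)^{r₂}` (★ `dedekindGammaFactor`), `Λ_F = γ_F · ζ_F` (★ `completedDedekindZeta`, an honest product).  Since `ζ_F^S = ζ_F · E_S` on `Re s > 1`
(★ `F0P2wPartialDedekindZetaPole.partialDedekindZeta_eq_dedekindZetaCont_mul`), on the tube `1 < Re z`:
  `ζ_F^S(2z−1)∕ζ_F^S(2z) = B_S(z) · Λ_F(2z−1)∕Λ_F(2z)`,   `B_S(z) := (E_S(2z−1)∕E_S(2z)) · (γ_F(2z)∕γ_F(2z−1))`   (§1, `B_S` WRITTEN OUT — no definition).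
`B_S` is holomorphic and zero-free on the open half-plane `{½ < Re z}` (§1) — so the two currencies carry the same pole∕zero information there — but **`B_S(z) → 0` as `z → ½`**
(§2: `γ_F(2z−1)` has a pole of order `r₁ + r₂ ≥ 1` at `2z − 1 = 0`, Mathlib `Gammaℝ_residue_zero`).  CONSEQUENCE FOR THE SEAM (R90-CS-plan S8-R9; K2E1-p10's J2′): the `ζ^S`-side
factor `A` of the tube letter `q = A · ζ_F^S(2z−1)∕ζ_F^S(2z)` (★ p861868 `hsrc`: archimedean mean × bad-place means × Haar constant, holomorphic on `{½ < Re}` ONLY, ★ p861744) carries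
a POLE at `z = ½` — the centre value `qc(½)` is readable only in COMPLETED currency, and J2′ must deliver `A` in CLOSED FORM on the spherical line:
  `A(z) = a · (γ_F(2z−1)∕γ_F(2z)) · (E_S(2z)∕E_S(2z−1))`      (`|d_F|^{−½}` = the self-dual Haar constant sits inside `γ_F(2z−1)∕γ_F(2z)`),
whereupon `q = a · Λ_F(2z−1)∕Λ_F(2z)` on the tube (§3) and ★ `centreValue_eq_neg_of_tube_const` gives **`qc(½) = −a`** (§3), and the socket-shaped sum (§3, §4 for `F = L⁺`).
HONEST SCOPE.  NOT here: the closed form `hAcl` itself (= road J2′ proper: the E1 archimedean mean at the constant weight is the `Γ_ℝ`-ratio, the bad-place means are thin-factor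
quotients times `‖δ‖`-powers killed by the product formula — K2E1-p10's booked hand over ★ p861884 `chiArchMean_const_eq` ∕ `chiLocalMean_const_eq` and the J1a dictionary).
HONEST LABEL: HC_CM is proved only modulo the 7 printed citations (2 remaining named inputs: hLiu418 = `stmt-HodgeConjecture-24832`, h413 = `stmt-HodgeConjecture-24833`) until rung 0
closes; REL ≠ ★ ≠ BUILT; this file asserts no named fact and closes no socket; count-neutral.

* §1 `partialDedekindZeta_two_mul_ratio_eq` (the dictionary on the tube), `differentiableOn_conversionFactor`, `conversionFactor_ne_zero` (`{½ < Re}`), `thinEulerFactor_eq_finsetProd`.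
* §2 `tendsto_pow_mul_dedekindGammaFactor_zero` (`s^{r₁+r₂}·γ_F(s) → 2^{r₁+r₂} ≠ 0` at `s = 0`), **`tendsto_dedekindGammaFactor_ratio_centre`** (`γ_F(2z)∕γ_F(2z−1) → 0`),
  `tendsto_conversionFactor_centre` (`B_S → 0` along `𝓝[{½ < Re}] ½`).
* §3 `tube_eq_mul_completedRatio_of_zetaRatio`, `differentiableOn_mul_conversionFactor`, `tube_eq_const_mul_completedRatio` (+ `_of_finset`), **`centreValue_eq_neg_of_zeta_tube_const`**
  (+ `_of_finset`), **`sum_centreValue_smul_eq_neg_of_zeta_const`**.   * §4 CM print `sum_centreValue_smul_eq_neg_of_zeta_const_cm` (`F = L⁺`).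

## References
* [KeysShahidi1988] D. Keys, F. Shahidi, *Artin L-functions and normalization of intertwining operators*, Ann. Sci. ÉNS 21 (1988), Thm. 5.1.
* [Rogawski1990] J. D. Rogawski, *Automorphic Representations of Unitary Groups in Three Variables* (1990): Prop. 11.2.1 pp. 161–162, §13.9 p. 229.
* [NeukirchANT1999] J. Neukirch, *Algebraic Number Theory* (1999): Ch. VII (5.2) (Euler product), (5.10) Corollary (`Λ_K`, functional equation), (5.11).
* [Iwaniec2002] H. Iwaniec, *Spectral Methods of Automorphic Forms* (2nd ed., 2002): Thm. 3.4 ∕ (3.26) (`φ(s) = ξ(2s−1)∕ξ(2s)`).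
* [Langlands1976] R. P. Langlands, *On the Functional Equations Satisfied by Eisenstein Series*, LNM 544 (1976): Appendix (rank one: completed local factors).
-/

set_option autoImplicit false
set_option linter.dupNamespace false  -- the mandated namespace repeats the summit's segment (`HodgeConjecture.HodgeConjecture`)

noncomputable section

open Filter Topology Set Complex NumberField NumberField.InfinitePlace IsDedekindDomain
open Literature.NumberTheory.Automorphic Literature.NumberTheory.LFunctions
open Summit.HodgeConjecture.HodgeConjecture.Cruxes.H413.F0P2wPartialDedekindZetaPole (differentiableOn_thinEulerFactor thinEulerFactor_ne_zero
  partialDedekindZeta_eq_dedekindZetaCont_mul summable_residueCard_rpow_neg_of_finite)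
open Summit.HodgeConjecture.HodgeConjecture.Cruxes.H413.K2E1IntertwiningScalarCentreValueU2 (differentiableAt_dedekindGammaFactor_of_re_pos dedekindGammaFactor_ne_zero_of_re_pos'
  completedDedekindZeta_ne_zero_of_one_le_re centreValue_eq_neg_of_tube_const sum_centreValue_smul_eq_neg_of_const)

namespace Summit.HodgeConjecture.HodgeConjecture.Cruxes.H413.K2E1IntertwiningScalarCompletedRatioU2

variable (F : Type) [Field F] [NumberField F] {S : Set (HeightOneSpectrum (𝓞 F))}

/-! ## §1 The dictionary on the tube and the conversion factor `B_S(z) = (E_S(2z−1)∕E_S(2z))·(γ_F(2z)∕γ_F(2z−1))` on `{½ < Re}` -/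

omit [NumberField F] in
/-- Real parts of `2z` and `2z − 1`. [folklore] -/
theorem re_two_mul_and_sub_one (z : ℂ) : (2 * z).re = 2 * z.re ∧ (2 * z - 1).re = 2 * z.re - 1 := by
  constructor
  · simp only [mul_re, re_ofNat, im_ofNat, zero_mul, sub_zero]
  · simp only [sub_re, mul_re, re_ofNat, im_ofNat, zero_mul, sub_zero, one_re]

omit [NumberField F] in
/-- `2z ≠ 1` when `½ < Re z`. [folklore] -/
theorem two_mul_ne_one_of_half_lt_re {z : ℂ} (hz : 1 / 2 < z.re) : 2 * z ≠ 1 := by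
  intro h
  have : (2 * z).re = 1 := by rw [h]; simp
  rw [(re_two_mul_and_sub_one z).1] at this
  linarith

/-- **THE DICTIONARY ON THE TUBE**: for `S` finite and `1 < Re z`,
  `ζ_F^S(2z−1)∕ζ_F^S(2z) = [(E_S(2z−1)∕E_S(2z)) · (γ_F(2z)∕γ_F(2z−1))] · (Λ_F(2z−1)∕Λ_F(2z))`
(`ζ_F^S = ζ_F·E_S` ★ `partialDedekindZeta_eq_dedekindZetaCont_mul` at `2z−1` and `2z`, `ζ_F = Λ_F∕γ_F` with `γ_F ≠ 0` on `0 < Re`).  Here `ζ_F^S(s) = partialStandardL S (fun _ => {1}) s`.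
[cite: NeukirchANT1999, Ch. VII (5.2) and (5.10) Corollary] [cite: Langlands1976, Appendix] -/
theorem partialDedekindZeta_two_mul_ratio_eq (hS : S.Finite) {z : ℂ} (hz : 1 < z.re) :
    partialStandardL S (fun _ => {1}) (2 * z - 1) / partialStandardL S (fun _ => {1}) (2 * z) =
      (∏' v : S, (1 - ((v : HeightOneSpectrum (𝓞 F)).residueCard : ℂ) ^ (-(2 * z - 1)))) / (∏' v : S, (1 - ((v : HeightOneSpectrum (𝓞 F)).residueCard : ℂ) ^ (-(2 * z)))) *
        (dedekindGammaFactor F (2 * z) / dedekindGammaFactor F (2 * z - 1)) *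
        (completedDedekindZeta F (2 * z - 1) / completedDedekindZeta F (2 * z)) := by
  have hsum := summable_residueCard_rpow_neg_of_finite hS 0
  have hre := re_two_mul_and_sub_one z
  have h1 : 1 < (2 * z - 1).re := by rw [hre.2]; linarith
  have h2 : 1 < (2 * z).re := by rw [hre.1]; linarith
  rw [partialDedekindZeta_eq_dedekindZetaCont_mul hsum h1 (by linarith), partialDedekindZeta_eq_dedekindZetaCont_mul hsum h2 (by linarith)]
  have hγ1 : dedekindGammaFactor F (2 * z - 1) ≠ 0 := dedekindGammaFactor_ne_zero_of_re_pos' F (by linarith)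
  have hγ2 : dedekindGammaFactor F (2 * z) ≠ 0 := dedekindGammaFactor_ne_zero_of_re_pos' F (by linarith)
  have hE2 : ∏' v : S, (1 - ((v : HeightOneSpectrum (𝓞 F)).residueCard : ℂ) ^ (-(2 * z))) ≠ 0 := thinEulerFactor_ne_zero hsum (by linarith) (by linarith)
  have hζ2 : dedekindZetaCont F (2 * z) ≠ 0 := dedekindZetaCont_ne_zero_of_one_le_re_holds (K := F) h2.le (two_mul_ne_one_of_half_lt_re (by linarith))
  have hΛ : ∀ s : ℂ, completedDedekindZeta F s = dedekindGammaFactor F s * dedekindZetaCont F s := fun _ => rfl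
  rw [hΛ, hΛ]
  field_simp

/-- **`B_S` IS HOLOMORPHIC ON `{½ < Re}`** (`E_S` holomorphic everywhere relevant and `≠ 0` on `0 < Re`, ★ `F0P2wPartialDedekindZetaPole`; `γ_F` holomorphic and `≠ 0` on `0 < Re`, ★
`K2E1IntertwiningScalarCentreValueU2`; `Re(2z−1) > 0 ⟺ Re z > ½`). [cite: NeukirchANT1999, Ch. VII (5.10) Corollary] -/
theorem differentiableOn_conversionFactor (hS : S.Finite) :
    DifferentiableOn ℂ (fun z : ℂ =>
      (∏' v : S, (1 - ((v : HeightOneSpectrum (𝓞 F)).residueCard : ℂ) ^ (-(2 * z - 1)))) / (∏' v : S, (1 - ((v : HeightOneSpectrum (𝓞 F)).residueCard : ℂ) ^ (-(2 * z)))) *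
        (dedekindGammaFactor F (2 * z) / dedekindGammaFactor F (2 * z - 1))) {z : ℂ | 1 / 2 < z.re} := by
  have hsum := summable_residueCard_rpow_neg_of_finite hS (-1)
  have hE : DifferentiableOn ℂ (fun s : ℂ => ∏' v : S, (1 - ((v : HeightOneSpectrum (𝓞 F)).residueCard : ℂ) ^ (-s))) {s : ℂ | (-1 : ℝ) < s.re} :=
    differentiableOn_thinEulerFactor hsum
  intro z hz
  have hz' : 1 / 2 < z.re := hz
  have hre := re_two_mul_and_sub_one z
  have h2 : DifferentiableAt ℂ (fun w : ℂ => 2 * w) z := (differentiableAt_const _).mul differentiableAt_id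
  have h21 : DifferentiableAt ℂ (fun w : ℂ => 2 * w - 1) z := h2.sub (differentiableAt_const _)
  have hopen : IsOpen {s : ℂ | (-1 : ℝ) < s.re} := isOpen_lt continuous_const continuous_re
  have hE1 := (hE.differentiableAt (hopen.mem_nhds (show (-1 : ℝ) < (2 * z - 1).re by rw [hre.2]; linarith))).comp z h21
  have hE2 := (hE.differentiableAt (hopen.mem_nhds (show (-1 : ℝ) < (2 * z).re by rw [hre.1]; linarith))).comp z h2
  have hE2ne : ∏' v : S, (1 - ((v : HeightOneSpectrum (𝓞 F)).residueCard : ℂ) ^ (-(2 * z))) ≠ 0 :=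
    thinEulerFactor_ne_zero hsum (by rw [hre.1]; linarith) (by rw [hre.1]; linarith)
  have hγ2 := (differentiableAt_dedekindGammaFactor_of_re_pos F (show 0 < (2 * z).re by rw [hre.1]; linarith)).comp z h2
  have hγ1 := (differentiableAt_dedekindGammaFactor_of_re_pos F (show 0 < (2 * z - 1).re by rw [hre.2]; linarith)).comp z h21
  have hγ1ne : dedekindGammaFactor F (2 * z - 1) ≠ 0 := dedekindGammaFactor_ne_zero_of_re_pos' F (by rw [hre.2]; linarith)
  exact ((hE1.div hE2 hE2ne).mul (hγ2.div hγ1 hγ1ne)).differentiableWithinAt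

/-- **`B_S(z) ≠ 0` FOR `½ < Re z`** — the two currencies carry the same zeros and poles on the open half-plane. [cite: NeukirchANT1999, Ch. VII (5.10) Corollary] -/
theorem conversionFactor_ne_zero (hS : S.Finite) {z : ℂ} (hz : 1 / 2 < z.re) :
    (∏' v : S, (1 - ((v : HeightOneSpectrum (𝓞 F)).residueCard : ℂ) ^ (-(2 * z - 1)))) / (∏' v : S, (1 - ((v : HeightOneSpectrum (𝓞 F)).residueCard : ℂ) ^ (-(2 * z)))) *
        (dedekindGammaFactor F (2 * z) / dedekindGammaFactor F (2 * z - 1)) ≠ 0 := by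
  have hsum := summable_residueCard_rpow_neg_of_finite hS (-1)
  have hre := re_two_mul_and_sub_one z
  refine mul_ne_zero (div_ne_zero ?_ ?_) (div_ne_zero ?_ ?_)
  · exact thinEulerFactor_ne_zero hsum (by rw [hre.2]; linarith) (by rw [hre.2]; linarith)
  · exact thinEulerFactor_ne_zero hsum (by rw [hre.1]; linarith) (by rw [hre.1]; linarith)
  · exact dedekindGammaFactor_ne_zero_of_re_pos' F (by rw [hre.1]; linarith)
  · exact dedekindGammaFactor_ne_zero_of_re_pos' F (by rw [hre.2]; linarith)

/-- **FINSET FORM OF THE THIN FACTOR** (seam note of K2E1-p10 (g3), 16:33:58Z (b)): for finite `S`, `∏'_{v ∈ S} (1 − q_v^{−s}) = ∏_{v ∈ hS.toFinset} (1 − q_v^{−s})` — so road J2′ may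
deliver the closed form with honest `Finset` products. [folklore] -/
theorem thinEulerFactor_eq_finsetProd (hS : S.Finite) (s : ℂ) :
    ∏' v : S, (1 - ((v : HeightOneSpectrum (𝓞 F)).residueCard : ℂ) ^ (-s)) = ∏ v ∈ hS.toFinset, (1 - (v.residueCard : ℂ) ^ (-s)) :=
  calc ∏' v : S, (1 - ((v : HeightOneSpectrum (𝓞 F)).residueCard : ℂ) ^ (-s))
      = ∏' v : (↑hS.toFinset : Set (HeightOneSpectrum (𝓞 F))), (1 - ((v : HeightOneSpectrum (𝓞 F)).residueCard : ℂ) ^ (-s)) :=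
        tprod_congr_set_coe (fun v : HeightOneSpectrum (𝓞 F) => 1 - (v.residueCard : ℂ) ^ (-s)) hS.coe_toFinset.symm
    _ = ∏ v ∈ hS.toFinset, (1 - (v.residueCard : ℂ) ^ (-s)) :=
        Finset.tprod_subtype' hS.toFinset (fun v : HeightOneSpectrum (𝓞 F) => 1 - (v.residueCard : ℂ) ^ (-s))

/-! ## §2 At the centre the conversion factor VANISHES: `γ_F(2z)∕γ_F(2z−1) → 0` -/

/-- **`s^{r₁+r₂} · γ_F(s) → 2^{r₁+r₂}` as `s → 0`, `s ≠ 0`** — `γ_F` has a pole of order exactly `r₁ + r₂` at `s = 0`: `s·Γ_ℝ(s) → 2` (Mathlib `Gammaℝ_residue_zero`),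
`s·Γ_ℂ(s) = (s·Γ_ℝ(s))·Γ_ℝ(s+1) → 2·Γ_ℝ(1) = 2`, `|d_F|^{s∕2} → 1`. [cite: NeukirchANT1999, Ch. VII (5.10) Corollary] -/
theorem tendsto_pow_mul_dedekindGammaFactor_zero :
    Tendsto (fun s : ℂ => s ^ (nrRealPlaces F + nrComplexPlaces F) * dedekindGammaFactor F s) (𝓝[≠] 0) (𝓝 (2 ^ (nrRealPlaces F + nrComplexPlaces F))) := by
  have hd0 : ((discr F).natAbs : ℂ) ≠ 0 := Nat.cast_ne_zero.mpr (Int.natAbs_ne_zero.mpr (discr_ne_zero F))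
  -- `|d|^{s/2} → 1`
  have hdisc : Tendsto (fun s : ℂ => ((discr F).natAbs : ℂ) ^ (s / 2)) (𝓝[≠] 0) (𝓝 1) := by
    have hc : ContinuousAt (fun s : ℂ => ((discr F).natAbs : ℂ) ^ (s / 2)) 0 :=
      (DifferentiableAt.const_cpow (differentiableAt_id.div_const 2) (Or.inl hd0)).continuousAt
    have h := hc.tendsto
    rw [zero_div, cpow_zero] at h
    exact h.mono_left nhdsWithin_le_nhds
  -- `s·Γ_ℝ(s) → 2` and `s·Γ_ℂ(s) → 2`
  have hR : Tendsto (fun s : ℂ => s * Gammaℝ s) (𝓝[≠] 0) (𝓝 2) := Gammaℝ_residue_zero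
  have hR1 : Tendsto (fun s : ℂ => Gammaℝ (s + 1)) (𝓝[≠] 0) (𝓝 1) := by
    have hc : ContinuousAt (fun s : ℂ => Gammaℝ (s + 1)) 0 := by
      have h1 : DifferentiableAt ℂ Gammaℝ ((0 : ℂ) + 1) := Complex.differentiableAt_Gammaℝ_of_ne_zero (Gammaℝ_ne_zero_of_re_pos (by simp))
      exact (h1.comp (0 : ℂ) (differentiableAt_id.add (differentiableAt_const _))).continuousAt
    have h := hc.tendsto
    rw [zero_add, Gammaℝ_one] at h
    exact h.mono_left nhdsWithin_le_nhds
  have hC : Tendsto (fun s : ℂ => s * Gammaℂ s) (𝓝[≠] 0) (𝓝 2) := by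
    have h := hR.mul hR1
    rw [mul_one] at h
    refine h.congr fun s => ?_
    show s * Gammaℝ s * Gammaℝ (s + 1) = s * Gammaℂ s
    rw [mul_assoc, Gammaℝ_mul_Gammaℝ_add_one]
  have h := (hdisc.mul (hR.pow (nrRealPlaces F))).mul (hC.pow (nrComplexPlaces F))
  rw [one_mul, ← pow_add] at h
  refine h.congr fun s => ?_
  show ((discr F).natAbs : ℂ) ^ (s / 2) * (s * Gammaℝ s) ^ nrRealPlaces F * (s * Gammaℂ s) ^ nrComplexPlaces F =
    s ^ (nrRealPlaces F + nrComplexPlaces F) * (((discr F).natAbs : ℂ) ^ (s / 2) * Gammaℝ s ^ nrRealPlaces F * Gammaℂ s ^ nrComplexPlaces F)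
  rw [mul_pow, mul_pow, pow_add]
  ring

/-- `r₁ + r₂ ≥ 1` (a number field has an infinite place: `r₁ + 2r₂ = [F:ℚ] ≥ 1`). [folklore] -/
theorem one_le_nrRealPlaces_add_nrComplexPlaces : 1 ≤ nrRealPlaces F + nrComplexPlaces F := by
  have h := card_add_two_mul_card_eq_rank F
  have hpos : 0 < Module.finrank ℚ F := Module.finrank_pos
  omega

/-- **THE GAMMA RATIO VANISHES AT THE CENTRE: `γ_F(2z)∕γ_F(2z−1) → 0` as `z → ½`, `z ≠ ½`** — numerator `→ γ_F(1)`, denominator has a pole of order `r₁ + r₂ ≥ 1` at `2z − 1 = 0`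
(`(2z−1)^{r₁+r₂}·γ_F(2z−1) → 2^{r₁+r₂} ≠ 0` while `(2z−1)^{r₁+r₂} → 0`).  HONEST CONSEQUENCE: a `ζ^S`-currency tube factor `A` continuous at `½` would force `qc(½) = 0`; the true
`A` (archimedean mean) has a pole there. [cite: NeukirchANT1999, Ch. VII (5.10) Corollary] [cite: Langlands1976, Appendix] -/
theorem tendsto_dedekindGammaFactor_ratio_centre :
    Tendsto (fun z : ℂ => dedekindGammaFactor F (2 * z) / dedekindGammaFactor F (2 * z - 1)) (𝓝[≠] (1 / 2 : ℂ)) (𝓝 0) := by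
  set m : ℕ := nrRealPlaces F + nrComplexPlaces F with hm
  have hm1 : 1 ≤ m := one_le_nrRealPlaces_add_nrComplexPlaces F
  -- `z ↦ 2z − 1` maps `𝓝[≠] ½` into `𝓝[≠] 0`; `z ↦ 2z` tends to `1`
  have h21 : Tendsto (fun z : ℂ => 2 * z - 1) (𝓝[≠] (1 / 2 : ℂ)) (𝓝[≠] 0) := by
    refine tendsto_nhdsWithin_iff.mpr ⟨?_, ?_⟩
    · have hc : Tendsto (fun z : ℂ => 2 * z - 1) (𝓝 (1 / 2 : ℂ)) (𝓝 (2 * (1 / 2) - 1)) := ((continuous_const.mul continuous_id).sub continuous_const).tendsto _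
      rw [show (2 : ℂ) * (1 / 2) - 1 = 0 by norm_num] at hc
      exact hc.mono_left nhdsWithin_le_nhds
    · filter_upwards [self_mem_nhdsWithin] with z hz
      intro h
      apply hz
      have h' : (2 : ℂ) * z - 1 = 0 := h
      show z = 1 / 2
      linear_combination h' / 2
  have h2 : Tendsto (fun z : ℂ => 2 * z) (𝓝[≠] (1 / 2 : ℂ)) (𝓝 1) := by
    have hc : Tendsto (fun z : ℂ => 2 * z) (𝓝 (1 / 2 : ℂ)) (𝓝 (2 * (1 / 2))) := (continuous_const.mul continuous_id).tendsto _
    rw [show (2 : ℂ) * (1 / 2) = 1 by norm_num] at hc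
    exact hc.mono_left nhdsWithin_le_nhds
  -- numerator `γ_F(2z)·(2z−1)^m → γ_F(1)·0 = 0`, denominator `(2z−1)^m·γ_F(2z−1) → 2^m ≠ 0`
  have hγc : ContinuousAt (dedekindGammaFactor F) 1 := (differentiableAt_dedekindGammaFactor_of_re_pos F (by simp)).continuousAt
  have hnum : Tendsto (fun z : ℂ => dedekindGammaFactor F (2 * z) * (2 * z - 1) ^ m) (𝓝[≠] (1 / 2 : ℂ)) (𝓝 0) := by
    have hp : Tendsto (fun z : ℂ => (2 * z - 1) ^ m) (𝓝[≠] (1 / 2 : ℂ)) (𝓝 0) := by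
      have h := ((tendsto_nhdsWithin_iff.mp h21).1).pow m
      rwa [zero_pow (by omega : m ≠ 0)] at h
    have h := (hγc.tendsto.comp h2).mul hp
    rwa [mul_zero] at h
  have hden : Tendsto (fun z : ℂ => (2 * z - 1) ^ m * dedekindGammaFactor F (2 * z - 1)) (𝓝[≠] (1 / 2 : ℂ)) (𝓝 (2 ^ m)) :=
    (tendsto_pow_mul_dedekindGammaFactor_zero F).comp h21
  have hne : (2 : ℂ) ^ m ≠ 0 := pow_ne_zero _ two_ne_zero
  have hlim := hnum.div hden hne
  rw [zero_div] at hlim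
  refine hlim.congr' ?_
  filter_upwards [self_mem_nhdsWithin] with z hz
  have hz' : (2 : ℂ) * z - 1 ≠ 0 := by
    intro h
    apply hz
    show z = 1 / 2
    linear_combination h / 2
  simp only [Pi.div_apply]
  rw [mul_comm ((2 * z - 1) ^ m) (dedekindGammaFactor F (2 * z - 1))]
  exact mul_div_mul_right _ _ (pow_ne_zero _ hz')

/-- **`B_S → 0` ALONG `𝓝[{½ < Re}] ½`**: the thin-factor quotient tends to the finite `E_S(0)∕E_S(1)` while the gamma ratio tends to `0`.  (So the product `A·B_S` of §3 can be continuous at `½`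
with a non-zero value only if `A` blows up there — as the archimedean mean does.) [cite: NeukirchANT1999, Ch. VII (5.10) Corollary] -/
theorem tendsto_conversionFactor_centre (hS : S.Finite) :
    Tendsto (fun z : ℂ =>
      (∏' v : S, (1 - ((v : HeightOneSpectrum (𝓞 F)).residueCard : ℂ) ^ (-(2 * z - 1)))) / (∏' v : S, (1 - ((v : HeightOneSpectrum (𝓞 F)).residueCard : ℂ) ^ (-(2 * z)))) *
        (dedekindGammaFactor F (2 * z) / dedekindGammaFactor F (2 * z - 1))) (𝓝[≠] (1 / 2 : ℂ)) (𝓝 0) := by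
  have hsum := summable_residueCard_rpow_neg_of_finite hS (-1)
  have hE : DifferentiableOn ℂ (fun s : ℂ => ∏' v : S, (1 - ((v : HeightOneSpectrum (𝓞 F)).residueCard : ℂ) ^ (-s))) {s : ℂ | (-1 : ℝ) < s.re} :=
    differentiableOn_thinEulerFactor hsum
  have hopen : IsOpen {s : ℂ | (-1 : ℝ) < s.re} := isOpen_lt continuous_const continuous_re
  have hEc : ∀ s₀ : ℂ, (-1 : ℝ) < s₀.re →
      Tendsto (fun s : ℂ => ∏' v : S, (1 - ((v : HeightOneSpectrum (𝓞 F)).residueCard : ℂ) ^ (-s))) (𝓝 s₀)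
        (𝓝 (∏' v : S, (1 - ((v : HeightOneSpectrum (𝓞 F)).residueCard : ℂ) ^ (-s₀)))) :=
    fun s₀ hs₀ => (hE.differentiableAt (hopen.mem_nhds hs₀)).continuousAt.tendsto
  have h21 : Tendsto (fun z : ℂ => 2 * z - 1) (𝓝[≠] (1 / 2 : ℂ)) (𝓝 0) := by
    have hc : Tendsto (fun z : ℂ => 2 * z - 1) (𝓝 (1 / 2 : ℂ)) (𝓝 (2 * (1 / 2) - 1)) := ((continuous_const.mul continuous_id).sub continuous_const).tendsto _
    rw [show (2 : ℂ) * (1 / 2) - 1 = 0 by norm_num] at hc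
    exact hc.mono_left nhdsWithin_le_nhds
  have h2 : Tendsto (fun z : ℂ => 2 * z) (𝓝[≠] (1 / 2 : ℂ)) (𝓝 1) := by
    have hc : Tendsto (fun z : ℂ => 2 * z) (𝓝 (1 / 2 : ℂ)) (𝓝 (2 * (1 / 2))) := (continuous_const.mul continuous_id).tendsto _
    rw [show (2 : ℂ) * (1 / 2) = 1 by norm_num] at hc
    exact hc.mono_left nhdsWithin_le_nhds
  have hE1 := (hEc 0 (by simp)).comp h21
  have hE2 := (hEc 1 (by simp)).comp h2
  have hE2ne : ∏' v : S, (1 - ((v : HeightOneSpectrum (𝓞 F)).residueCard : ℂ) ^ (-(1 : ℂ))) ≠ 0 :=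
    thinEulerFactor_ne_zero hsum (by simp) (by simp)
  have h := (hE1.div hE2 hE2ne).mul (tendsto_dedekindGammaFactor_ratio_centre F)
  rw [mul_zero] at h
  exact h

/-! ## §3 Carrying a `ζ^S`-currency tube letter to the completed currency and to the centre value -/

/-- **FROM `q = A·ζ_F^S(2z−1)∕ζ_F^S(2z)` TO `q = (A·B_S)·Λ_F(2z−1)∕Λ_F(2z)` ON THE TUBE** (the INPUT shape is ★ p861868 `exists_sub_one_mul_qc_eq_of_oneSource`'s `hsrc` at `ε = 1`:
`(1 : HeckeCharacter F).valueAtUniformizer v = 1`). [cite: Rogawski1990, §13.9 p. 229] [cite: Langlands1976, Appendix] -/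
theorem tube_eq_mul_completedRatio_of_zetaRatio (hS : S.Finite) {q A : ℂ → ℂ}
    (hsrcζ : ∀ z : ℂ, 1 < z.re → q z = A z * (partialStandardL S (fun _ => {1}) (2 * z - 1) / partialStandardL S (fun _ => {1}) (2 * z))) :
    ∀ z : ℂ, 1 < z.re → q z =
      (A z * ((∏' v : S, (1 - ((v : HeightOneSpectrum (𝓞 F)).residueCard : ℂ) ^ (-(2 * z - 1)))) / (∏' v : S, (1 - ((v : HeightOneSpectrum (𝓞 F)).residueCard : ℂ) ^ (-(2 * z)))) *
        (dedekindGammaFactor F (2 * z) / dedekindGammaFactor F (2 * z - 1)))) *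
      (completedDedekindZeta F (2 * z - 1) / completedDedekindZeta F (2 * z)) := by
  intro z hz
  rw [hsrcζ z hz, partialDedekindZeta_two_mul_ratio_eq F hS hz]
  ring

/-- The completed-side factor `A·B_S` is holomorphic on `{½ < Re}` when `A` is. [folklore] -/
theorem differentiableOn_mul_conversionFactor (hS : S.Finite) {A : ℂ → ℂ} (hA : DifferentiableOn ℂ A {z : ℂ | 1 / 2 < z.re}) :
    DifferentiableOn ℂ (fun z : ℂ => A z * ((∏' v : S, (1 - ((v : HeightOneSpectrum (𝓞 F)).residueCard : ℂ) ^ (-(2 * z - 1)))) /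
        (∏' v : S, (1 - ((v : HeightOneSpectrum (𝓞 F)).residueCard : ℂ) ^ (-(2 * z)))) * (dedekindGammaFactor F (2 * z) / dedekindGammaFactor F (2 * z - 1))))
      {z : ℂ | 1 / 2 < z.re} :=
  hA.mul (differentiableOn_conversionFactor F hS)

/-- **THE CLOSED FORM ON THE SPHERICAL LINE GIVES THE COMPLETED LETTER**: if `q = A·ζ_F^S(2z−1)∕ζ_F^S(2z)` on the tube and `A(z) = a·(γ_F(2z−1)∕γ_F(2z))·(E_S(2z)∕E_S(2z−1))` there (road
J2′: archimedean mean × Haar = `γ_F(2z−1)∕γ_F(2z)`, bad-place means = thin-factor quotient), then `q = a·Λ_F(2z−1)∕Λ_F(2z)` on the tube — ★ `centreValue_eq_neg_of_tube_const`'s `hsrc` verbatim.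
[cite: Rogawski1990, Prop. 11.2.1 pp. 161–162] [cite: Iwaniec2002, Thm. 3.4] [cite: Langlands1976, Appendix] -/
theorem tube_eq_const_mul_completedRatio (hS : S.Finite) {q A : ℂ → ℂ} {a : ℂ}
    (hsrcζ : ∀ z : ℂ, 1 < z.re → q z = A z * (partialStandardL S (fun _ => {1}) (2 * z - 1) / partialStandardL S (fun _ => {1}) (2 * z)))
    (hAcl : ∀ z : ℂ, 1 < z.re → A z = a * (dedekindGammaFactor F (2 * z - 1) / dedekindGammaFactor F (2 * z)) *
      ((∏' v : S, (1 - ((v : HeightOneSpectrum (𝓞 F)).residueCard : ℂ) ^ (-(2 * z)))) / (∏' v : S, (1 - ((v : HeightOneSpectrum (𝓞 F)).residueCard : ℂ) ^ (-(2 * z - 1)))))) :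
    ∀ z : ℂ, 1 < z.re → q z = a * (completedDedekindZeta F (2 * z - 1) / completedDedekindZeta F (2 * z)) := by
  intro z hz
  have hsum := summable_residueCard_rpow_neg_of_finite hS (-1)
  have hre := re_two_mul_and_sub_one z
  have hE1 : ∏' v : S, (1 - ((v : HeightOneSpectrum (𝓞 F)).residueCard : ℂ) ^ (-(2 * z - 1))) ≠ 0 :=
    thinEulerFactor_ne_zero hsum (by rw [hre.2]; linarith) (by rw [hre.2]; linarith)
  have hE2 : ∏' v : S, (1 - ((v : HeightOneSpectrum (𝓞 F)).residueCard : ℂ) ^ (-(2 * z))) ≠ 0 :=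
    thinEulerFactor_ne_zero hsum (by rw [hre.1]; linarith) (by rw [hre.1]; linarith)
  have hγ1 : dedekindGammaFactor F (2 * z - 1) ≠ 0 := dedekindGammaFactor_ne_zero_of_re_pos' F (by rw [hre.2]; linarith)
  have hγ2 : dedekindGammaFactor F (2 * z) ≠ 0 := dedekindGammaFactor_ne_zero_of_re_pos' F (by rw [hre.1]; linarith)
  rw [tube_eq_mul_completedRatio_of_zetaRatio F hS hsrcζ z hz, hAcl z hz]
  congr 1
  field_simp

/-- **THE CENTRE VALUE FROM A `ζ^S`-CURRENCY TUBE LETTER IN CLOSED FORM: `qc(½) = −a`.**  One coordinate of a continued scattering package — tube value `q`, continuation `qc` analytic off the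
co-discrete `P`, `qc = q` on the tube, meromorphic in normal form at `½` (★ clause shapes `hqcq hPcd hqa` + clause 4) — with the `ζ^S`-side letter `hsrcζ` (★ p861868 tokens at `ε = 1`) and the
closed form `hAcl` of its factor on the spherical line ⟹ `qc(½) = −a` (★ `centreValue_eq_neg_of_tube_const` ∘ §3).  This is `M(½) = −1` on the spherical line of `U(1,1)_{L∕L⁺}` for
`χ|C_{L⁺} = 1`. [cite: KeysShahidi1988, Thm. 5.1] [cite: Rogawski1990, Prop. 11.2.1 pp. 161–162] -/
theorem centreValue_eq_neg_of_zeta_tube_const (hS : S.Finite) {q qc A : ℂ → ℂ} {a : ℂ} {P : Set ℂ}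
    (hqcq : ∀ z : ℂ, 1 < z.re → qc z = q z) (hPcd : ∀ z₀ : ℂ, ∀ᶠ s in 𝓝[≠] z₀, s ∉ P) (hqa : ∀ z : ℂ, z ∉ P → AnalyticAt ℂ qc z)
    (hqm : MeromorphicNFAt qc (1 / 2 : ℂ))
    (hsrcζ : ∀ z : ℂ, 1 < z.re → q z = A z * (partialStandardL S (fun _ => {1}) (2 * z - 1) / partialStandardL S (fun _ => {1}) (2 * z)))
    (hAcl : ∀ z : ℂ, 1 < z.re → A z = a * (dedekindGammaFactor F (2 * z - 1) / dedekindGammaFactor F (2 * z)) *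
      ((∏' v : S, (1 - ((v : HeightOneSpectrum (𝓞 F)).residueCard : ℂ) ^ (-(2 * z)))) / (∏' v : S, (1 - ((v : HeightOneSpectrum (𝓞 F)).residueCard : ℂ) ^ (-(2 * z - 1)))))) :
    qc (1 / 2 : ℂ) = -a :=
  centreValue_eq_neg_of_tube_const F hPcd hqa hqm fun z hz => by
    rw [hqcq z hz]
    exact tube_eq_const_mul_completedRatio F hS hsrcζ hAcl z hz

/-- **FINSET-FORM CLOSED LETTER ⟹ THE COMPLETED LETTER** (same as `tube_eq_const_mul_completedRatio`, the thin factors written as `Finset` products over `hS.toFinset`).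
[cite: Rogawski1990, Prop. 11.2.1 pp. 161–162] [cite: Langlands1976, Appendix] -/
theorem tube_eq_const_mul_completedRatio_of_finset (hS : S.Finite) {q A : ℂ → ℂ} {a : ℂ}
    (hsrcζ : ∀ z : ℂ, 1 < z.re → q z = A z * (partialStandardL S (fun _ => {1}) (2 * z - 1) / partialStandardL S (fun _ => {1}) (2 * z)))
    (hAcl' : ∀ z : ℂ, 1 < z.re → A z = a * (dedekindGammaFactor F (2 * z - 1) / dedekindGammaFactor F (2 * z)) *
      ((∏ v ∈ hS.toFinset, (1 - (v.residueCard : ℂ) ^ (-(2 * z)))) / (∏ v ∈ hS.toFinset, (1 - (v.residueCard : ℂ) ^ (-(2 * z - 1)))))) :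
    ∀ z : ℂ, 1 < z.re → q z = a * (completedDedekindZeta F (2 * z - 1) / completedDedekindZeta F (2 * z)) :=
  tube_eq_const_mul_completedRatio F hS hsrcζ fun z hz => by
    rw [hAcl' z hz, thinEulerFactor_eq_finsetProd F hS, thinEulerFactor_eq_finsetProd F hS]

/-- **`qc(½) = −a` FROM THE FINSET-FORM CLOSED LETTER** (as `centreValue_eq_neg_of_zeta_tube_const`). [cite: KeysShahidi1988, Thm. 5.1] [cite: Rogawski1990, Prop. 11.2.1 pp. 161–162] -/
theorem centreValue_eq_neg_of_zeta_tube_const_of_finset (hS : S.Finite) {q qc A : ℂ → ℂ} {a : ℂ} {P : Set ℂ}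
    (hqcq : ∀ z : ℂ, 1 < z.re → qc z = q z) (hPcd : ∀ z₀ : ℂ, ∀ᶠ s in 𝓝[≠] z₀, s ∉ P) (hqa : ∀ z : ℂ, z ∉ P → AnalyticAt ℂ qc z)
    (hqm : MeromorphicNFAt qc (1 / 2 : ℂ))
    (hsrcζ : ∀ z : ℂ, 1 < z.re → q z = A z * (partialStandardL S (fun _ => {1}) (2 * z - 1) / partialStandardL S (fun _ => {1}) (2 * z)))
    (hAcl' : ∀ z : ℂ, 1 < z.re → A z = a * (dedekindGammaFactor F (2 * z - 1) / dedekindGammaFactor F (2 * z)) *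
      ((∏ v ∈ hS.toFinset, (1 - (v.residueCard : ℂ) ^ (-(2 * z)))) / (∏ v ∈ hS.toFinset, (1 - (v.residueCard : ℂ) ^ (-(2 * z - 1)))))) :
    qc (1 / 2 : ℂ) = -a :=
  centreValue_eq_neg_of_tube_const F hPcd hqa hqm fun z hz => by
    rw [hqcq z hz]
    exact tube_eq_const_mul_completedRatio_of_finset F hS hsrcζ hAcl' z hz

/-- **THE SOCKET-SHAPED SUM FROM `ζ^S`-CURRENCY LETTERS IN CLOSED FORM**: `∑ j, qc j (1∕2) • bV j = −φ` for `φ = ∑ j, a j • bV j`, per-coordinate package clauses, `ζ^S`-side tube letters and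
their closed forms with the constants `a j` (the spherical line). [cite: KeysShahidi1988, Thm. 5.1] [cite: Rogawski1990, Prop. 11.2.1 pp. 161–162; Prop. 13.6.2 (6) p. 210] -/
theorem sum_centreValue_smul_eq_neg_of_zeta_const (hS : S.Finite) {X : Type*} [AddCommGroup X] [Module ℂ X] {ι' : Type*} [Fintype ι'] (bV : ι' → X) {φ : X}
    (a : ι' → ℂ) (hφ : ∑ j, a j • bV j = φ) (q qc A : ι' → ℂ → ℂ) {P : Set ℂ}
    (hqcq : ∀ j (z : ℂ), 1 < z.re → qc j z = q j z) (hPcd : ∀ z₀ : ℂ, ∀ᶠ s in 𝓝[≠] z₀, s ∉ P) (hqa : ∀ j (z : ℂ), z ∉ P → AnalyticAt ℂ (qc j) z)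
    (hqm : ∀ j, MeromorphicNFAt (qc j) (1 / 2 : ℂ))
    (hsrcζ : ∀ j (z : ℂ), 1 < z.re → q j z = A j z * (partialStandardL S (fun _ => {1}) (2 * z - 1) / partialStandardL S (fun _ => {1}) (2 * z)))
    (hAcl : ∀ j (z : ℂ), 1 < z.re → A j z = a j * (dedekindGammaFactor F (2 * z - 1) / dedekindGammaFactor F (2 * z)) *
      ((∏' v : S, (1 - ((v : HeightOneSpectrum (𝓞 F)).residueCard : ℂ) ^ (-(2 * z)))) / (∏' v : S, (1 - ((v : HeightOneSpectrum (𝓞 F)).residueCard : ℂ) ^ (-(2 * z - 1)))))) :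
    ∑ j, qc j (1 / 2 : ℂ) • bV j = -φ :=
  sum_centreValue_smul_eq_neg_of_const F bV a hφ qc hPcd hqa hqm fun j z hz => by
    rw [hqcq j z hz]
    exact tube_eq_const_mul_completedRatio F hS (hsrcζ j) (hAcl j) z hz

/-! ## §4 The CM print `F = L⁺` -/

section CM

variable (L : Type) [Field L] [NumberField L]

/-- **THE `U(1,1)_{L∕L⁺}` PRINT** (`F := L⁺`, totally real: `γ_{L⁺}(s) = |d_{L⁺}|^{s∕2} Γ_ℝ(s)^{[L⁺:ℚ]}`): per-coordinate package clauses, `ζ_{L⁺}^S`-currency tube letters and their closed forms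
on the spherical line ⟹ `∑ j, qc j (1∕2) • bV j = −φ` — the conclusion of `sock_S8_ext_kysCentreU2`. [cite: KeysShahidi1988, Thm. 5.1] [cite: Rogawski1990, Prop. 11.2.1 pp. 161–162] -/
theorem sum_centreValue_smul_eq_neg_of_zeta_const_cm {S : Set (HeightOneSpectrum (𝓞 ↥(maximalRealSubfield L)))} (hS : S.Finite)
    {X : Type*} [AddCommGroup X] [Module ℂ X] {ι' : Type*} [Fintype ι'] (bV : ι' → X) {φ : X}
    (a : ι' → ℂ) (hφ : ∑ j, a j • bV j = φ) (q qc A : ι' → ℂ → ℂ) {P : Set ℂ}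
    (hqcq : ∀ j (z : ℂ), 1 < z.re → qc j z = q j z) (hPcd : ∀ z₀ : ℂ, ∀ᶠ s in 𝓝[≠] z₀, s ∉ P) (hqa : ∀ j (z : ℂ), z ∉ P → AnalyticAt ℂ (qc j) z)
    (hqNF : ∀ j, MeromorphicNFOn (qc j) univ)
    (hsrcζ : ∀ j (z : ℂ), 1 < z.re → q j z = A j z * (partialStandardL S (fun _ => {1}) (2 * z - 1) / partialStandardL S (fun _ => {1}) (2 * z)))
    (hAcl : ∀ j (z : ℂ), 1 < z.re → A j z = a j * (dedekindGammaFactor ↥(maximalRealSubfield L) (2 * z - 1) / dedekindGammaFactor ↥(maximalRealSubfield L) (2 * z)) *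
      ((∏' v : S, (1 - ((v : HeightOneSpectrum (𝓞 ↥(maximalRealSubfield L))).residueCard : ℂ) ^ (-(2 * z)))) /
        (∏' v : S, (1 - ((v : HeightOneSpectrum (𝓞 ↥(maximalRealSubfield L))).residueCard : ℂ) ^ (-(2 * z - 1)))))) :
    ∑ j, qc j (1 / 2 : ℂ) • bV j = -φ :=
  sum_centreValue_smul_eq_neg_of_zeta_const ↥(maximalRealSubfield L) hS bV a hφ q qc A hqcq hPcd hqa (fun j => hqNF j (mem_univ _)) hsrcζ hAcl

end CM

end Summit.HodgeConjecture.HodgeConjecture.Cruxes.H413.K2E1IntertwiningScalarCompletedRatioU2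

end
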